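import Summits.HubbardSuperconductivity.HubbardSuperconductivity.Theorems.AnisotropyChordTransferFibre3Cs2Rows

/-!
# Route `AnisotropyChord` / H0 rotor rung: ★ THEOREM (KT-2b-cs2) `Cs2RealSpaceBound` PROVED (PartN32, memo 21 §304(c))

For an x-mirror-symmetric two-magnon profile `f` with `|f| ≤ M` (theory seat `hubbard-h0-rotor-theory-1`):
`cs2 ≤ 4ε₁Q₀X + ε₁R̄(Γ_M + 2f_nn²M²) + 2ε₁√(4Q₀X·Γ_M R̄)`.
Assembly of `…Fibre3Cs2Fold` (fold) and `…Fibre3Cs2Rows` (row estimates): rows `a = 0` vanish (hard core), the contact row `a = x̂`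
gives `2ε₁f_nn²M²R̄`, and the generic rows give `Σ_a R(a)Φ₊(a)` with `Φ₊(a) = Σ_b|A₊|² ≤ |α̃|²Q₀ + ε₁Γ + 2|α̃|√Q₀√(ε₁Γ)`,
`Σ_a R|α̃|² = 4ε₁X`, `Σ_a R|α̃| ≤ √R̄ √(4ε₁X)` (Cauchy–Schwarz) — no `ε`-optimisation needed.
**`cs2RealSpaceBound_holds (Δ) : Cs2RealSpaceBound L Δ`** (every `L`; `L = 1` is vacuous).  With `pairSplitCS_holds`,
`offPoleTailFromPieces_holds`, `nTermBound_holds`, `denMinRest_closedForm` this completes PartN32 except the lattice-sum inputs.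
Prover seat `hubbard-h0-rotor-p1` g22; helper for stmt-HubbardSuperconductivity-19089 (`--supports`).
-/

set_option linter.dupNamespace false
set_option autoImplicit false

noncomputable section

open scoped BigOperators
open Complex

namespace Summit.HubbardSuperconductivity.HubbardSuperconductivity.Theorems.AnisotropyChord.Transfer.Fibre3

variable (L : ℕ) [NeZero L]

/-- a two-magnon profile forces `L ≥ 2` (`L = 1`: `x̂ = 0` and `0 < f(x̂) = f(0) = 0`). [folklore] -/
theorem two_le_of_isTwoMagnon {Δ lam2 : ℝ} {f : Tor L → ℝ} (hf : IsTwoMagnon L Δ lam2 f) : 2 ≤ L := by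
  by_contra h
  have hL0 : L ≠ 0 := NeZero.ne L
  have hL1 : L = 1 := by omega
  obtain ⟨h0, -, hpos, -, -⟩ := hf
  subst hL1
  have : K1 1 = 0 := Subsingleton.elim _ _
  rw [this, h0] at hpos
  exact lt_irrefl _ hpos

/-! ## Rows -/

/-- the row `a = 0` lies in the hard core. [folklore] -/
theorem row_zero (f : Tor L → ℝ) : ∑ b : Tor L, cs2term L f (0, b) = 0 := by
  apply Finset.sum_eq_zero
  intro b _
  unfold cs2term InD
  simp

/-- a generic row is dominated by `R(a) Φ₊(a)`. [folklore] -/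
theorem row_generic_le (Δ : ℝ) (f : Tor L → ℝ) {a : Tor L} (ha0 : a ≠ 0) (ha1 : a ≠ K1 L) :
    ∑ b : Tor L, cs2term L f (a, b) ≤ Rwt L Δ f a * ∑ b : Tor L, Complex.normSq (Aplus L f (a, b)) := by
  rw [Finset.mul_sum]
  apply Finset.sum_le_sum
  intro b _
  have hR : (f a - f (a - K1 L)) ^ 2 = Rwt L Δ f a := by rw [Rwt_eq_gradx_sq L Δ f ha0 ha1]; rfl
  unfold cs2term
  split_ifs
  · exact mul_nonneg (Rwt_nonneg L Δ f a) (Complex.normSq_nonneg _)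
  · simp only [hR]; exact le_rfl

/-- **`Φ₊(a) ≤ |α̃(a)|²Q₀ + ε₁Γ_M + 2|α̃(a)|√Q₀√(ε₁Γ_M)`.** [folklore] -/
theorem Phi_le {Δ lam2 M : ℝ} {f : Tor L → ℝ} (hf : IsTwoMagnon L Δ lam2 f) (hM : ∀ r : Tor L, |f r| ≤ M)
    (a : Tor L) :
    ∑ b : Tor L, Complex.normSq (Aplus L f (a, b))
      ≤ ‖alphaT L a‖ ^ 2 * Q0 L f + eps1 L * GammaM L Δ f M
        + 2 * ‖alphaT L a‖ * (Real.sqrt (Q0 L f) * Real.sqrt (eps1 L * GammaM L Δ f M)) := by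
  have hL := two_le_of_isTwoMagnon L hf
  -- pointwise
  have hpt : ∀ b : Tor L, Complex.normSq (Aplus L f (a, b))
      ≤ ‖alphaT L a‖ ^ 2 * P1 L f (a, b) ^ 2 + ‖Zterm L f (a, b)‖ ^ 2
        + 2 * ‖alphaT L a‖ * (|P1 L f (a, b)| * ‖Zterm L f (a, b)‖) := by
    intro b
    rw [Complex.normSq_eq_norm_sq, Aplus_decomp]
    have h1 := norm_add_le (alphaT L a * ((P1 L f (a, b) : ℝ) : ℂ)) (Zterm L f (a, b))
    rw [norm_mul, Complex.norm_real, Real.norm_eq_abs] at h1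
    have h0 : 0 ≤ ‖alphaT L a * ((P1 L f (a, b) : ℝ) : ℂ) + Zterm L f (a, b)‖ := norm_nonneg _
    have := sq_abs (P1 L f (a, b))
    nlinarith [norm_nonneg (alphaT L a), abs_nonneg (P1 L f (a, b)), norm_nonneg (Zterm L f (a, b))]
  -- sums
  have hP := sum_P1_sq_le L f a
  have hZ : ∑ b : Tor L, ‖Zterm L f (a, b)‖ ^ 2 ≤ eps1 L * GammaM L Δ f M := by
    rw [← Finset.sum_congr rfl fun b _ => Complex.normSq_eq_norm_sq (Zterm L f (a, b))]
    exact sum_normSq_Z_le L hL hf hM a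
  have hcs := Real.sum_mul_le_sqrt_mul_sqrt Finset.univ (fun b : Tor L => |P1 L f (a, b)|)
    (fun b : Tor L => ‖Zterm L f (a, b)‖)
  simp only [sq_abs] at hcs
  have hQ0 := Q0_nonneg L f
  have hcross : ∑ b : Tor L, |P1 L f (a, b)| * ‖Zterm L f (a, b)‖
      ≤ Real.sqrt (Q0 L f) * Real.sqrt (eps1 L * GammaM L Δ f M) :=
    hcs.trans (mul_le_mul (Real.sqrt_le_sqrt hP) (Real.sqrt_le_sqrt hZ) (Real.sqrt_nonneg _) (Real.sqrt_nonneg _))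
  have hα : 0 ≤ ‖alphaT L a‖ := norm_nonneg _
  calc ∑ b : Tor L, Complex.normSq (Aplus L f (a, b))
      ≤ ∑ b : Tor L, (‖alphaT L a‖ ^ 2 * P1 L f (a, b) ^ 2 + ‖Zterm L f (a, b)‖ ^ 2
          + 2 * ‖alphaT L a‖ * (|P1 L f (a, b)| * ‖Zterm L f (a, b)‖)) := Finset.sum_le_sum fun b _ => hpt b
    _ = ‖alphaT L a‖ ^ 2 * ∑ b : Tor L, P1 L f (a, b) ^ 2 + ∑ b : Tor L, ‖Zterm L f (a, b)‖ ^ 2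
          + 2 * ‖alphaT L a‖ * ∑ b : Tor L, |P1 L f (a, b)| * ‖Zterm L f (a, b)‖ := by
        rw [Finset.sum_add_distrib, Finset.sum_add_distrib, ← Finset.mul_sum, ← Finset.mul_sum]
    _ ≤ _ := by
        have hα2 : 0 ≤ ‖alphaT L a‖ ^ 2 := sq_nonneg _
        nlinarith [mul_le_mul_of_nonneg_left hP hα2, mul_le_mul_of_nonneg_left hcross (by positivity : 0 ≤ 2 * ‖alphaT L a‖)]

/-- `‖α̃(a)‖² = 4ε₁(1 − cos θ(aₓ−1))`. [folklore] -/
theorem norm_alphaT_sq (hL : 2 ≤ L) (a : Tor L) :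
    ‖alphaT L a‖ ^ 2 = 4 * eps1 L * (1 - Real.cos (2 * Real.pi * ((a.1.val : ℝ) - 1) / L)) := by
  rw [← Complex.normSq_eq_norm_sq]; exact normSq_alphaT L hL a

/-- `Σ_a R(a)‖α̃(a)‖² = 4ε₁ X`. [folklore] -/
theorem sum_Rwt_alpha_sq (hL : 2 ≤ L) (Δ : ℝ) (f : Tor L → ℝ) :
    ∑ a : Tor L, Rwt L Δ f a * ‖alphaT L a‖ ^ 2 = 4 * eps1 L * Xmom L Δ f := by
  unfold Xmom
  rw [Finset.mul_sum]
  refine Finset.sum_congr rfl fun a _ => ?_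
  rw [norm_alphaT_sq L hL]; ring

/-- `Σ_a R(a)‖α̃(a)‖ ≤ √R̄ √(4ε₁X)` (Cauchy–Schwarz). [folklore] -/
theorem sum_Rwt_alpha_le (hL : 2 ≤ L) (Δ : ℝ) (f : Tor L → ℝ) :
    ∑ a : Tor L, Rwt L Δ f a * ‖alphaT L a‖ ≤ Real.sqrt (Rbar L Δ f) * Real.sqrt (4 * eps1 L * Xmom L Δ f) := by
  have hcs := Real.sum_mul_le_sqrt_mul_sqrt Finset.univ (fun a : Tor L => Real.sqrt (Rwt L Δ f a))
    (fun a : Tor L => Real.sqrt (Rwt L Δ f a) * ‖alphaT L a‖)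
  have h1 : ∀ a : Tor L, Real.sqrt (Rwt L Δ f a) * (Real.sqrt (Rwt L Δ f a) * ‖alphaT L a‖) = Rwt L Δ f a * ‖alphaT L a‖ := by
    intro a; rw [← mul_assoc, Real.mul_self_sqrt (Rwt_nonneg L Δ f a)]
  have h2 : ∀ a : Tor L, Real.sqrt (Rwt L Δ f a) ^ 2 = Rwt L Δ f a := fun a => Real.sq_sqrt (Rwt_nonneg L Δ f a)
  have h3 : ∀ a : Tor L, (Real.sqrt (Rwt L Δ f a) * ‖alphaT L a‖) ^ 2 = Rwt L Δ f a * ‖alphaT L a‖ ^ 2 := by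
    intro a; rw [mul_pow, h2]
  simp only [h1, h2, h3] at hcs
  rw [sum_Rwt_alpha_sq L hL] at hcs
  exact hcs

/-! ## The theorem -/

/-- ★ **THEOREM (KT-2b-cs2): `Cs2RealSpaceBound L Δ` holds** (every `L`). [folklore] -/
theorem cs2RealSpaceBound_holds (Δ : ℝ) : Cs2RealSpaceBound L Δ := by
  intro lam2 M f hf hsym hM
  have hL := two_le_of_isTwoMagnon L hf
  have hK : K1 L ≠ 0 := K1_ne_zero L hL
  have hε : 0 ≤ eps1 L := by unfold eps1; linarith [Real.cos_le_one (2 * Real.pi / L)]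
  have hR := Rbar_nonneg L Δ f
  have hX := Xmom_nonneg L Δ f
  have hQ := Q0_nonneg L f
  have hΓ : 0 ≤ GammaM L Δ f M := by
    unfold GammaM; have := sq_nonneg (f (K1 L)); positivity
  -- Φ bound per row, uniform pieces
  set SQ := Real.sqrt (Q0 L f) with hSQ
  set SG := Real.sqrt (eps1 L * GammaM L Δ f M) with hSG
  have hΦ : ∀ a : Tor L, ∑ b : Tor L, Complex.normSq (Aplus L f (a, b))
      ≤ ‖alphaT L a‖ ^ 2 * Q0 L f + eps1 L * GammaM L Δ f M + 2 * ‖alphaT L a‖ * (SQ * SG) :=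
    fun a => Phi_le L hf hM a
  -- row bound
  have hrow : ∀ a : Tor L, ∑ b : Tor L, cs2term L f (a, b)
      ≤ (if a = K1 L then 2 * eps1 L * f (K1 L) ^ 2 * M ^ 2 * Rbar L Δ f else 0)
        + Rwt L Δ f a * (‖alphaT L a‖ ^ 2 * Q0 L f + eps1 L * GammaM L Δ f M + 2 * ‖alphaT L a‖ * (SQ * SG)) := by
    intro a
    have hRa := Rwt_nonneg L Δ f a
    have hΦa := hΦ a
    have hΦ0 : 0 ≤ ∑ b : Tor L, Complex.normSq (Aplus L f (a, b)) := Finset.sum_nonneg fun b _ => Complex.normSq_nonneg _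
    by_cases ha0 : a = 0
    · subst ha0
      rw [row_zero, if_neg (fun h => hK h.symm)]
      nlinarith [mul_nonneg hRa hΦ0]
    · by_cases ha1 : a = K1 L
      · subst ha1
        rw [if_pos rfl]
        have h := contact_row_le L hL hf hM
        nlinarith [mul_nonneg hRa hΦ0]
      · rw [if_neg ha1, zero_add]
        exact (row_generic_le L Δ f ha0 ha1).trans (mul_le_mul_of_nonneg_left hΦa hRa)
  -- sum the rows
  rw [cs2_fold L hsym, Fintype.sum_prod_type]
  refine (Finset.sum_le_sum fun a _ => hrow a).trans ?_
  rw [Finset.sum_add_distrib, Finset.sum_ite_eq' Finset.univ (K1 L)]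
  simp only [Finset.mem_univ, if_true]
  have hsplit : ∑ a : Tor L, Rwt L Δ f a * (‖alphaT L a‖ ^ 2 * Q0 L f + eps1 L * GammaM L Δ f M + 2 * ‖alphaT L a‖ * (SQ * SG))
      = Q0 L f * ∑ a : Tor L, Rwt L Δ f a * ‖alphaT L a‖ ^ 2 + eps1 L * GammaM L Δ f M * ∑ a : Tor L, Rwt L Δ f a
        + 2 * (SQ * SG) * ∑ a : Tor L, Rwt L Δ f a * ‖alphaT L a‖ := by
    rw [Finset.mul_sum, Finset.mul_sum, Finset.mul_sum, ← Finset.sum_add_distrib, ← Finset.sum_add_distrib]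
    refine Finset.sum_congr rfl fun a _ => ?_; ring
  rw [hsplit, sum_Rwt_alpha_sq L hL]
  have hRb : ∑ a : Tor L, Rwt L Δ f a = Rbar L Δ f := rfl
  rw [hRb]
  have hcs := sum_Rwt_alpha_le L hL Δ f
  -- the cross term: √Q₀ √(ε₁Γ) √R̄ √(4ε₁X) = ε₁ √(4Q₀X·ΓR̄)
  have hcross : SQ * SG * (Real.sqrt (Rbar L Δ f) * Real.sqrt (4 * eps1 L * Xmom L Δ f))
      = eps1 L * Real.sqrt (4 * Q0 L f * Xmom L Δ f * (GammaM L Δ f M * Rbar L Δ f)) := by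
    rw [hSQ, hSG, ← Real.sqrt_mul hQ, ← Real.sqrt_mul hR, ← Real.sqrt_mul (mul_nonneg hQ (mul_nonneg hε hΓ)),
      show Q0 L f * (eps1 L * GammaM L Δ f M) * (Rbar L Δ f * (4 * eps1 L * Xmom L Δ f))
        = eps1 L ^ 2 * (4 * Q0 L f * Xmom L Δ f * (GammaM L Δ f M * Rbar L Δ f)) by ring,
      Real.sqrt_mul (sq_nonneg _), Real.sqrt_sq hε]
  have hSS : 0 ≤ SQ * SG := mul_nonneg (Real.sqrt_nonneg _) (Real.sqrt_nonneg _)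
  have hfin : 2 * (SQ * SG) * ∑ a : Tor L, Rwt L Δ f a * ‖alphaT L a‖
      ≤ 2 * eps1 L * Real.sqrt (4 * Q0 L f * Xmom L Δ f * (GammaM L Δ f M * Rbar L Δ f)) := by
    have h := mul_le_mul_of_nonneg_left hcs hSS
    rw [hcross] at h
    linarith
  linarith [hfin]

end Summit.HubbardSuperconductivity.HubbardSuperconductivity.Theorems.AnisotropyChord.Transfer.Fibre3

end
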